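import Literature.NumberTheory.Rogawski1990.UnitFundamentalLemmaInertOffCount
import Literature.NumberTheory.Rogawski1990.UnitFundamentalLemmaExplicitNonsplitOfPlaces
import Literature.NumberTheory.Rogawski1990.UnitFundamentalLemmaInertLeviClause
import Literature.NumberTheory.Automorphic.UnitOrbitalIntegralSplitTorusHSide
import Literature.NumberTheory.Rogawski1990.LocalCentralizerTorusMeasureCM
import Literature.NumberTheory.Rogawski1990.UnitOrbitalIntegralInertClosedForms
import Literature.NumberTheory.Rogawski1990.UnitFundamentalLemmaInertIrredClauseOfValuesStubFrame
import Literature.NumberTheory.Rogawski1990.UnitFundamentalLemmaInertFlickerAlgebraTypeTwo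
import Literature.NumberTheory.Rogawski1990.FinExplicitTransferFactorInertExponentStub
import Literature.NumberTheory.Rogawski1990.FinExplicitTransferFactorInertExponentSplitStub
import Literature.NumberTheory.Rogawski1990.UnitStableOrbitalIntegralHSideValueStubFrame
import Literature.NumberTheory.Rogawski1990.UnitStableOrbitalIntegralHSideValueTypeTwo
import Literature.NumberTheory.Automorphic.UnitaryCyclicCentralizerCompactNonsplit
import Literature.NumberTheory.Rogawski1990.UnitFundamentalLemmaInertFlickerAlgebra
import Literature.NumberTheory.Rogawski1990.UnitFundamentalLemmaInertSplitClauseOfValuesStubFrame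
import Literature.NumberTheory.Rogawski1990.UnitFundamentalLemmaInertFlickerScalarsCM
import Literature.NumberTheory.Automorphic.RankTwoEigenframeOfSplitCharpoly
import Literature.NumberTheory.Rogawski1990.LocalHyperbolicClassIsLevi
import Literature.NumberTheory.Automorphic.SplitOrthogonalUnramifiedDatum
import Literature.NumberTheory.Rogawski1990.UnitFundamentalLemmaInertSplitValueOne
import Literature.NumberTheory.Automorphic.AdicCompletionIntegersAdicComplete
import Literature.NumberTheory.Rogawski1990.UnitFundamentalLemmaInertSplitValuesThetaOne
import Literature.NumberTheory.Rogawski1990.UnitFundamentalLemmaInertIrredValuePos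
import Literature.NumberTheory.Rogawski1990.UnitOrbitalIntegralInertValueTHprimeClosed
import HarnessLib

/-!
# The unit fundamental lemma at the NON-SPLIT places — `UnitFundamentalLemmaExplicitNonsplitClosed` PROVED

This file DISCHARGES the named fact ★ `UnitFundamentalLemmaExplicitNonsplitClosed` ([Rogawski1990, Prop. 4.9.1 (b)], the inert unit
fundamental lemma for `(U(3), U(2) × U(1))` = [BlasiusRogawski1992FL]; in-house route: the elementary proof of [Flicker1998UnitaryFL],
THM 15 ∕ THM 18): `theorem unitFundamentalLemmaExplicitNonsplitClosed_holds : UnitFundamentalLemmaExplicitNonsplitClosed`, hypothesis-free,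
axioms {propext, Classical.choice, Quot.sound}.

It is the gate port of the sorry-free crux workfile «N7nsCount» ED. 1.7 (cell F0∕P3a: architect A-p06; hands A-p03, A-p13, B-p04, B-p10,
B-p12, B-p14, F0P3-p01∕p02, F0P3b-p01, F0P3a-p04; LEAD F0P3a-plan), whose content cannot be imported from `Cruxes/`.  The ≈ 50-line local
frame (place data, Haar∕canonical orbital measures, level masses, the explicit transfer factor `Δ‴_v`) is stated ONCE, in the per-place
theorem `isLocalUnitTransfer_of_nonsplit_of_isUnit_two` (§1), whose proof is the population split of the workfile with every population
paid by ★ Literature theorems BY NAME: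
* (P4) non-integral `χ_{ι(γ_H)}` and (P1) residually regular stable classes — ★ `…_of_offCount_of_nonsplit'` (Kottwitz);
* (P2) Levi classes — ★ `UnitFundamentalLemmaInertLeviClause` over the `H`-side torus value ★ `UnitOrbitalIntegralSplitTorusHSide`;
* (P3)-split (elliptic, `χ_g` split over `L_w`, torus `(E¹)³`) — exponents ★ `exists_flicker_exponents_split`, the four `G′`-values
  ★ `classOrbitalIntegral_indicator_eq_phiZero_of_congr` (Flicker Props. 13∕14) ∕ ★ `…_eq_phiOne_of_congr_splitTwo∕Three∕Four` (Prop. 11)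
  through the values-abstract assembly ★ `finsum_finExplicitDelta_mul_classOrbitalIntegral_eq_of_split_of_values'`, the `H`-value
  ★ `stableOrbitalIntegralRel_indicator_eq_phiH_of_isRoot`, and the identity ★ `Flicker1998.flicker_theorem15_div` (THM 15);
* (P3)-irreducible (elliptic, `χ_g` irreducible, torus `(EL)¹ × E¹`) — exponents ★ `exists_irredExponents_of_hint`, compact centraliser
  ★ `compactSpace_centralizer_of_not_exists_isRoot`, values ★ `…_eq_phiTHn_of_finKappaAt_eq_one` (Props. 10–11, 16) ∕
  ★ `…_eq_phiTHprimen_of_finKappaAt_eq_neg_one` (Prop. 17) ∕ ★ `…_eq_phiHtwo_of_not_exists_isRoot`, the adapter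
  ★ `…_of_not_exists_isRoot_of_values` and ★ `Flicker1998.flicker_theorem18n_halg` (THM 18).
§2 adds the cofinite guard «`2 ∈ 𝒪_w^×`» (Flicker's standing `p ≠ 2`), §3 feeds §1 into the abstract-guard socket
★ `unitFundamentalLemmaExplicitNonsplit_of_forall_place_of_eventually` at every frame of the closed letter.

Design: THEOREMS ONLY (no def ∕ instance ∕ notation); default heartbeats; NOT here: the split places (★ `UnitFundamentalLemmaExplicitSplit`),
the assembled letter N7 (★ `unitFundamentalLemmaExplicitClosed_of_nonsplitClosed` composes the two halves).

## References
* [Rogawski1990] J. D. Rogawski, *Automorphic Representations of Unitary Groups in Three Variables* (1990): §4.9 Prop. 4.9.1 (b) p. 55; §4.3 (4.3.1) p. 43.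
* [Flicker1998UnitaryFL] Y. Z. Flicker, *Elementary proof of the fundamental lemma for a unitary group*, Canad. J. Math. 50 (1998) 74–98: Prop. 3 p. 78,
  Props. 11–14 pp. 87–94, THM 15 p. 95, Props. 16–17, THM 18 pp. 96–97.
* [BlasiusRogawski1992FL] D. Blasius, J. D. Rogawski, *Fundamental lemmas for U(3) and related groups* (CRM 1992) §0 pp. 363–364, §6 pp. 387–391.
* [Kottwitz1986] R. E. Kottwitz, *Base change for unit elements of Hecke algebras*, Compositio Math. 60 (1986): §7.
-/

set_option autoImplicit false

noncomputable section

open MeasureTheory Measure Set Function NumberField IsDedekindDomain Matrix Polynomial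
open Literature.NumberTheory.Automorphic Literature.NumberTheory.Automorphic.UnitaryGroup
open Literature.NumberTheory.Automorphic.IntegralReduction Literature.NumberTheory.GaloisRepresentations
open scoped Matrix MatrixGroups ValuativeRel

namespace Literature.NumberTheory.Rogawski1990

section PerPlace

variable (L : Type) [Field L] [NumberField L] [IsCMField L] (H' : Matrix (Fin 3) (Fin 3) L)
  {v : HeightOneSpectrum (𝓞 ↥(maximalRealSubfield L))}

/-! ## §1 The clause at one non-split place, for EVERY `G`-regular `γ_H` (populations (P1)–(P4)) -/

open scoped Classical in
/-- **The inert unit fundamental lemma at ONE non-split place `v` of good reduction with `2 ∈ 𝒪_w^×`**: at an unramified non-split `v`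
(`w ∣ v`, `c • w = w`) with `H′_w ∈ GL₃(𝒪_w)`, `μ` unramified at `w` and `μ|_{𝕀_{L⁺}} = ω_{L∕L⁺}`, canonical orbital-measure families
`mH, mG` for Haar measures giving the hyperspecial levels mass `1`, and `2` a `w`-adic unit (Flicker's «`p ≠ 2`»):
`IsLocalUnitTransfer L H′ v Δ‴_v mH mG`, i.e. for EVERY `G`-regular `γ_H ∈ H_v`,
`Φ^st(γ_H, 1_{K_H}) = ∑ᶠ c, Δ‴_v(γ_H, out c) · Φ(c, 1_{K′})`.  Proof = the population split: non-integral `χ_{ι(γ_H)}` or stably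
conjugate to a residually regular element of `K_H` (★ off-count, Kottwitz) — Levi type (★ Levi clause over the ★ `U(1,1)` split-torus
`H`-value) — elliptic with `χ_g` split over `L_w` (Flicker THM 15 over the ★ four `G′`-values and the ★ `H`-value) — elliptic with `χ_g`
irreducible (Flicker THM 18 over the ★ two `G′`-values, the ★ `H`-value and the ★ compact centraliser).
[cite: Rogawski1990, §4.9 Prop. 4.9.1 (b) p. 55; §4.3 (4.3.1) p. 43] [cite: Flicker1998UnitaryFL, Thm. 15 p. 95; Thm. 18 p. 97] -/
theorem isLocalUnitTransfer_of_nonsplit_of_isUnit_two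
    (hH' : (H'.map (IsCMField.complexConj L))ᵀ = H') (w : PlacesOver L v)
    (hw : IsCMField.complexConj L • w.1 = w.1) (hv : Algebra.IsUnramifiedIn (𝓞 L) v.asIdeal)
    (hH'w : IsUnit (placeForm H' w.1)) (hH'i : hH'w.unit ∈ glInt 3 (w.1.adicCompletion L))
    (μ : HeckeCharacter L) (hμ : μ.IsUnramifiedAt w.1)
    [MeasurableSpace ((cmDatum L 3 H').Local v)] [BorelSpace ((cmDatum L 3 H').Local v)]
    [∀ γ : ((cmDatum L 3 H').Local v), MeasurableSpace (((cmDatum L 3 H').Local v) ⧸ Subgroup.centralizer ({γ} : Set ((cmDatum L 3 H').Local v)))]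
    [∀ γ : ((cmDatum L 3 H').Local v), BorelSpace (((cmDatum L 3 H').Local v) ⧸ Subgroup.centralizer ({γ} : Set ((cmDatum L 3 H').Local v)))]
    [MeasurableSpace ((cmDatum L 2 (Matrix.of fun i j : Fin 2 => if i.val + j.val + 1 = 2 then (1 : L) else 0)).Local v ×
      (cmDatum L 1 (Matrix.of fun i j : Fin 1 => if i.val + j.val + 1 = 1 then (1 : L) else 0)).Local v)]
    [BorelSpace ((cmDatum L 2 (Matrix.of fun i j : Fin 2 => if i.val + j.val + 1 = 2 then (1 : L) else 0)).Local v ×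
      (cmDatum L 1 (Matrix.of fun i j : Fin 1 => if i.val + j.val + 1 = 1 then (1 : L) else 0)).Local v)]
    [∀ a : ((cmDatum L 2 (Matrix.of fun i j : Fin 2 => if i.val + j.val + 1 = 2 then (1 : L) else 0)).Local v ×
      (cmDatum L 1 (Matrix.of fun i j : Fin 1 => if i.val + j.val + 1 = 1 then (1 : L) else 0)).Local v),
      MeasurableSpace (((cmDatum L 2 (Matrix.of fun i j : Fin 2 => if i.val + j.val + 1 = 2 then (1 : L) else 0)).Local v ×
      (cmDatum L 1 (Matrix.of fun i j : Fin 1 => if i.val + j.val + 1 = 1 then (1 : L) else 0)).Local v) ⧸ Subgroup.centralizer ({a} : Set ((cmDatum L 2 (Matrix.of fun i j : Fin 2 => if i.val + j.val + 1 = 2 then (1 : L) else 0)).Local v ×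
      (cmDatum L 1 (Matrix.of fun i j : Fin 1 => if i.val + j.val + 1 = 1 then (1 : L) else 0)).Local v)))]
    [∀ a : ((cmDatum L 2 (Matrix.of fun i j : Fin 2 => if i.val + j.val + 1 = 2 then (1 : L) else 0)).Local v ×
      (cmDatum L 1 (Matrix.of fun i j : Fin 1 => if i.val + j.val + 1 = 1 then (1 : L) else 0)).Local v),
      BorelSpace (((cmDatum L 2 (Matrix.of fun i j : Fin 2 => if i.val + j.val + 1 = 2 then (1 : L) else 0)).Local v ×
      (cmDatum L 1 (Matrix.of fun i j : Fin 1 => if i.val + j.val + 1 = 1 then (1 : L) else 0)).Local v) ⧸ Subgroup.centralizer ({a} : Set ((cmDatum L 2 (Matrix.of fun i j : Fin 2 => if i.val + j.val + 1 = 2 then (1 : L) else 0)).Local v ×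
      (cmDatum L 1 (Matrix.of fun i j : Fin 1 => if i.val + j.val + 1 = 1 then (1 : L) else 0)).Local v)))]
    (νH : Measure ((cmDatum L 2 (Matrix.of fun i j : Fin 2 => if i.val + j.val + 1 = 2 then (1 : L) else 0)).Local v ×
      (cmDatum L 1 (Matrix.of fun i j : Fin 1 => if i.val + j.val + 1 = 1 then (1 : L) else 0)).Local v)) [νH.IsHaarMeasure] [νH.IsMulRightInvariant]
    (νG : Measure ((cmDatum L 3 H').Local v)) [νG.IsHaarMeasure] [νG.IsMulRightInvariant]
    {mH : OrbitalMeasureFamily ((cmDatum L 2 (Matrix.of fun i j : Fin 2 => if i.val + j.val + 1 = 2 then (1 : L) else 0)).Local v ×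
      (cmDatum L 1 (Matrix.of fun i j : Fin 1 => if i.val + j.val + 1 = 1 then (1 : L) else 0)).Local v)} {mG : OrbitalMeasureFamily ((cmDatum L 3 H').Local v)}
    (hmH : mH.IsCanonical (IsLocalGRegular L v) νH)
    (hmG : mG.IsCanonical (fun γ => IsRegularElt (γ.val : GL (Fin 3) (UnitaryGroup.LocalRing L v))) νG)
    (hνH : νH ((((cmLocalIntegralLevel L 2 (Matrix.of fun i j : Fin 2 => if i.val + j.val + 1 = 2 then (1 : L) else 0) v).prod
      (cmLocalIntegralLevel L 1 (Matrix.of fun i j : Fin 1 => if i.val + j.val + 1 = 1 then (1 : L) else 0) v)) : Subgroup ((cmDatum L 2 (Matrix.of fun i j : Fin 2 => if i.val + j.val + 1 = 2 then (1 : L) else 0)).Local v ×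
      (cmDatum L 1 (Matrix.of fun i j : Fin 1 => if i.val + j.val + 1 = 1 then (1 : L) else 0)).Local v)) : Set ((cmDatum L 2 (Matrix.of fun i j : Fin 2 => if i.val + j.val + 1 = 2 then (1 : L) else 0)).Local v ×
      (cmDatum L 1 (Matrix.of fun i j : Fin 1 => if i.val + j.val + 1 = 1 then (1 : L) else 0)).Local v)) = 1)
    (hνG : νG (cmLocalIntegralLevel L 3 H' v : Set ((cmDatum L 3 H').Local v)) = 1)
    (hl : ∀ (v : HeightOneSpectrum (𝓞 ↥(maximalRealSubfield L)))
      (a : (cmDatum L 2 (Matrix.of fun i j : Fin 2 => if i.val + j.val + 1 = 2 then (1 : L) else 0)).Local v ×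
      (cmDatum L 1 (Matrix.of fun i j : Fin 1 => if i.val + j.val + 1 = 1 then (1 : L) else 0)).Local v)
      (b : (cmDatum L 3 H').Local v)
      (x : (cmDatum L 2 (Matrix.of fun i j : Fin 2 => if i.val + j.val + 1 = 2 then (1 : L) else 0)).Local v ×
      (cmDatum L 1 (Matrix.of fun i j : Fin 1 => if i.val + j.val + 1 = 1 then (1 : L) else 0)).Local v),
      finExplicitDelta L v H' (x * a * x⁻¹) μ b = finExplicitDelta L v H' a μ b)
    (hr : ∀ (v : HeightOneSpectrum (𝓞 ↥(maximalRealSubfield L)))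
      (a : (cmDatum L 2 (Matrix.of fun i j : Fin 2 => if i.val + j.val + 1 = 2 then (1 : L) else 0)).Local v ×
      (cmDatum L 1 (Matrix.of fun i j : Fin 1 => if i.val + j.val + 1 = 1 then (1 : L) else 0)).Local v)
      (b y : (cmDatum L 3 H').Local v),
      finExplicitDelta L v H' a μ (y * b * y⁻¹) = finExplicitDelta L v H' a μ b)
    (hH'u : IsUnit H') (hμu : μ.IsUnitary)
    (hμω : ∀ x : ideleGroup ↥(maximalRealSubfield L), μ (AdeleRing.ideleBaseChange ↥(maximalRealSubfield L) L x) = quadraticHeckeCharCM L x)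
    (h2 : IsUnit (2 : 𝒪[w.1.adicCompletion L])) :
    IsLocalUnitTransfer L H' v (finExplicitCollection L H' μ hl hr v) mH mG := by
  haveI := Literature.NumberTheory.Automorphic.isAdicComplete_maximalIdeal_valuedInteger_adicCompletion L w.1
  have hq : 1 < Ideal.absNorm v.asIdeal :=
    Nat.one_lt_iff_ne_zero_and_ne_one.2 ⟨by rw [Ne, Ideal.absNorm_eq_zero_iff]; exact v.ne_bot,
      by rw [Ne, Ideal.absNorm_eq_one_iff]; exact v.isPrime.ne_top⟩
  have hiso := ValuativeRel.isEquiv (ValuativeRel.valuation (w.1.adicCompletion L))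
    (Valued.v : Valuation (w.1.adicCompletion L) (WithZero (Multiplicative ℤ)))
  intro γH hreg
  -- (P4) non-integral `χ_{ι(γ_H)}`: both sides vanish (★ off-count)
  by_cases hint : ∀ i : ℕ, ((((endoEmbLocal L v γH).val : GL (Fin 3) (LocalRing L v)).val.map
      (Pi.evalRingHom (fun w' : PlacesOver L v => w'.1.adicCompletion L) w)).charpoly.coeff i) ∈ 𝒪[w.1.adicCompletion L]
  swap
  · exact stableOrbitalIntegralRel_indicator_eq_finsum_finExplicitDelta_of_offCount_of_nonsplit' L H' hH' w hw hv hH'w hH'i μ hμ νH νG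
      hmH hmG hνH hνG hl hr (Or.inr hint)
  -- integrality in the `Valued.integer` currency of the ★ value files (equivalent valuations)
  have hintV : ∀ i : ℕ, ((((endoEmbLocal L v γH).val : GL (Fin 3) (UnitaryGroup.LocalRing L v)).val.map
      (Pi.evalRingHom (fun w' : PlacesOver L v => w'.1.adicCompletion L) w)).charpoly.coeff i) ∈ Valued.integer (w.1.adicCompletion L) :=
    fun i => (Valuation.mem_integer_iff _ _).2 ((hiso.le_one_iff_le_one).1 ((Valuation.mem_integer_iff _ _).1 (hint i)))
  -- (P1) stably conjugate to a residually regular element of `K_H` (★ off-count, Kottwitz)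
  by_cases hP1 : ∃ γH₀ : ((cmDatum L 2 (Matrix.of fun i j : Fin 2 => if i.val + j.val + 1 = 2 then (1 : L) else 0)).Local v ×
      (cmDatum L 1 (Matrix.of fun i j : Fin 1 => if i.val + j.val + 1 = 1 then (1 : L) else 0)).Local v),
        γH₀ ∈ ((cmLocalIntegralLevel L 2 (Matrix.of fun i j : Fin 2 => if i.val + j.val + 1 = 2 then (1 : L) else 0) v).prod
      (cmLocalIntegralLevel L 1 (Matrix.of fun i j : Fin 1 => if i.val + j.val + 1 = 1 then (1 : L) else 0) v)) ∧ IsLocalGRegular L v γH₀ ∧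
        (redMat (((endoEmbLocal L v γH₀).val : GL (Fin 3) (LocalRing L v)).val.map
          (Pi.evalRingHom (fun w' : PlacesOver L v => w'.1.adicCompletion L) w))).charpoly.Separable ∧
        IsLocalStablyConjH L v γH₀ γH
  · exact stableOrbitalIntegralRel_indicator_eq_finsum_finExplicitDelta_of_offCount_of_nonsplit' L H' hH' w hw hv hH'w hH'i μ hμ νH νG
      hmH hmG hνH hνG hl hr (Or.inl hP1)
  -- (P2) LEVI TYPE: an `H_v`-conjugate `y γ_H y⁻¹ = (diag(d′), u)` — ★ FILE G over the ★ `U(1,1)` split-torus `H`-value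
  by_cases hlev : ∃ (y : ((cmDatum L 2 (Matrix.of fun i j : Fin 2 => if i.val + j.val + 1 = 2 then (1 : L) else 0)).Local v ×
      (cmDatum L 1 (Matrix.of fun i j : Fin 1 => if i.val + j.val + 1 = 1 then (1 : L) else 0)).Local v)) (d' : Fin 2 → (UnitaryGroup.LocalRing L v)ˣ),
        glDiagonal 2 (UnitaryGroup.LocalRing L v) d' = ((y * γH * y⁻¹).1.val : GL (Fin 2) (UnitaryGroup.LocalRing L v))
  · obtain ⟨y, d', hyd'⟩ := hlev
    have hconj : IsConj γH (y * γH * y⁻¹) := isConj_iff.2 ⟨y, rfl⟩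
    have hreg₁ : IsLocalGRegular L v (y * γH * y⁻¹) := (isLocalGRegular_conj_iff L y γH).2 hreg
    obtain ⟨-, hb, -⟩ := isUnit_levi_of_isLocalGRegular_of_nonsplit L w hw hyd' hreg₁
    -- the conjugate `(diag(d′), u)` has integral characteristic polynomial too, hence lies in `K_H`
    have hint₁ : ∀ i : ℕ, ((((endoEmbLocal L v (y * γH * y⁻¹)).val : GL (Fin 3) (UnitaryGroup.LocalRing L v)).val.map
        (Pi.evalRingHom (fun w' : PlacesOver L v => w'.1.adicCompletion L) w)).charpoly.coeff i) ∈ Valued.integer (w.1.adicCompletion L) := by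
      intro i; rw [charpoly_map_endoEmbLocal_conj L w y γH]; exact hintV i
    have hK := mem_prod_cmLocalIntegralLevel_of_levi_of_integral_charpoly L w hw hyd' hint₁
    have hK₁ : ∀ x : (cmDatum L 1 (Matrix.of fun i j : Fin 1 => if i.val + j.val + 1 = 1 then (1 : L) else 0)).Local v,
        x ∈ cmLocalIntegralLevel L 1 (Matrix.of fun i j : Fin 1 => if i.val + j.val + 1 = 1 then (1 : L) else 0) v := by
      intro x
      rw [cmLocalIntegralLevel_one_eq_top_of_smul_eq L _ w hw (isUnit_placeForm_antidiagOne (N := 1) w.1)]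
      exact Subgroup.mem_top x
    -- the `H`-side value at `⟦γ_H⟧ = ⟦y γ_H y⁻¹⟧` (★ C′₂ at the canonical family `mH`, predicate `IsLocalGRegular`)
    have hΦH₁ := classOrbitalIntegral_indicator_prod_eq_inv_sqrt_of_torus_regular_of_nonsplit L w hw νH hmH hνH hK
      (isLocalGRegular_out_mk hreg₁) (isRegularElt_fst_snd_of_isLocalGRegular L v _ hreg₁).1 hyd' hb hK₁
    rw [← ConjClasses.mk_eq_mk_iff_isConj.2 hconj] at hΦH₁
    exact stableOrbitalIntegralRel_indicator_eq_finsum_finExplicitDelta_of_levi_conj_of_nonsplit L H' hH'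
      ((Matrix.isUnit_iff_isUnit_det H').1 hH'u) w hw hv hH'w hH'i μ hμ hμω νG hl hr mH hmG hνG hreg hintV y hyd' hb hΦH₁
  -- `2 ∈ 𝒪_w^×` in the two other currencies: `|2|_v = 1` on `L⁺_v` and a unit of `Valued.integer L_w`
  have h2w : Valued.v (2 : w.1.adicCompletion L) = 1 := (isUnit_two_integer_iff_valued_eq_one L w.1).1 h2
  have h2L : (2 : 𝓞 L) ∉ w.1.asIdeal := by
    have e1 : (algebraMap L (w.1.adicCompletion L)) (algebraMap (𝓞 L) L 2) = 2 := by rw [map_ofNat, map_ofNat]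
    have h2w' := h2w
    rw [← e1] at h2w'
    change Valued.v ((algebraMap (𝓞 L) L 2 : L) : w.1.adicCompletion L) = 1 at h2w'
    rw [HeightOneSpectrum.valuedAdicCompletion_eq_valuation', HeightOneSpectrum.valuation_of_algebraMap] at h2w'
    exact HeightOneSpectrum.intValuation_eq_one_iff.1 h2w'
  have h2F : (2 : 𝓞 ↥(maximalRealSubfield L)) ∉ v.asIdeal := by
    intro hmem
    apply h2L
    have h := congrArg HeightOneSpectrum.asIdeal w.2
    rw [← h] at hmem
    simp only [HeightOneSpectrum.under_asIdeal, Ideal.under_def, Ideal.mem_comap, map_ofNat] at hmem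
    exact hmem
  have h2v : Valued.v (2 : v.adicCompletion ↥(maximalRealSubfield L)) = 1 := valued_two_adicCompletion_eq_one v h2F
  have h2V : IsUnit (2 : Valued.integer (w.1.adicCompletion L)) := by
    have h := (Valuation.Integers.isUnit_iff_valuation_eq_one (Valuation.integer.integers _)).1 h2
    rw [Valuation.Integers.isUnit_iff_valuation_eq_one (Valuation.integer.integers _)]
    rw [map_ofNat] at h ⊢
    exact (hiso.eq_one_iff_eq_one).1 h
  by_cases hsplit : ∃ x : w.1.adicCompletion L, (((γH.1.val : GL (Fin 2) (LocalRing L v)).val.map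
        (Pi.evalRingHom (fun w' : PlacesOver L v => w'.1.adicCompletion L) w)).charpoly).IsRoot x
  · -- (P3)-split: ELLIPTIC with `χ_g` split over `L_w` — Flicker THM 15 on the torus `(E¹)³`
    obtain ⟨α, γ, N₁, N₂, N, hα, hγ, hαγ, hN₁, hN₂, hN, htri⟩ := exists_flicker_exponents_split L v w hw hreg hintV hsplit
    -- Flicker's scalars `e, π, x, y` and an eigenframe of `g` with `u₀(w) = α`, `u₁(w) = γ`, norm-one eigenvalues (★ (E1), (E3))
    obtain ⟨e, π, x, y, h2e, hσπ, hπu, hπN, hx, hy⟩ := exists_flicker_scalars_of_nonsplit L v w hw hv h2v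
    have hππ : π * (hπu.unit⁻¹ : (LocalRing L v)ˣ) = 1 := hπu.mul_val_inv
    have hsep : (((γH.1.val : GL (Fin 2) (LocalRing L v)) : Matrix (Fin 2) (Fin 2) (LocalRing L v)).charpoly).Separable :=
      (isRegularElt_fst_snd_of_isLocalGRegular L v γH hreg).1
    obtain ⟨P₂, u, hP₂, hu, hu0⟩ := exists_eigenframe_cmDatum_local_of_isRoot_map_of_separable L v w hw γH.1 hα hsep
    have hu1w : u 1 w = γ := by
      rcases eq_or_eq_eval_of_isRoot_of_eigenframe L v w hP₂ hγ with h | h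
      · exact absurd (h.trans hu0) (Ne.symm hαγ)
      · exact h.symm
    have hu1 : ∀ i, conjLocal L (IsCMField.complexConj L) v (u i) * u i = 1 :=
      forall_conjLocal_mul_eq_one_of_not_exists_conj_glDiagonal L v w hw hP₂ hu hlev
    have hP₂' : (γH.1.val.val : Matrix (Fin 2) (Fin 2) (LocalRing L v)) * P₂.val = P₂.val * diagonal ![u 0, u 1] := by
      rw [hP₂]; congr 1; ext i j; fin_cases i <;> fin_cases j <;> rfl
    have hαb : α ≠ finGammaTwo L v γH w := fun h0 => by
      rw [h0, sub_self, map_zero] at hN₁; exact WithZero.zero_ne_coe hN₁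
    have hγb : γ ≠ finGammaTwo L v γH w := fun h0 => by
      rw [h0, sub_self, map_zero] at hN₂; exact WithZero.zero_ne_coe hN₂
    have had : u 0 ≠ u 1 := fun h => zero_ne_one (hu h)
    have hab : u 0 ≠ finGammaTwo L v γH := fun h => hαb (by rw [← hu0, h])
    have hbd : finGammaTwo L v γH ≠ u 1 := fun h => hγb (by rw [← hu1w, ← h])
    have hsum : ∑ᶠ c : ConjClasses ((cmDatum L 3 H').Local v), (finExplicitCollection L H' μ hl hr v).Δ γH (Quotient.out c) *
          classOrbitalIntegral mG ((cmLocalIntegralLevel L 3 H' v : Set ((cmDatum L 3 H').Local v)).indicator fun _ => (1 : ℂ)) c =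
        (((((-((Ideal.absNorm v.asIdeal : ℕ) : ℚ)) ^ (N₁ + N₂))⁻¹ *
          Flicker1998.phiKappa (Ideal.absNorm v.asIdeal) N₁ N₂ N : ℚ)) : ℂ) := by
      -- the values-abstract assembly ★ HEAD 3′ with the four `G′`-VALUES ★ X₁ (Props. 13∕14) ∕ ★ X₂–X₄ (Prop. 11) BY NAME
      rw [finsum_finExplicitDelta_mul_classOrbitalIntegral_eq_of_split_of_values' L H' hH' w hw hv hH'w hH'i μ hμ hl hr hH'u hμω α γ N₁ N₂ hα hγ hαγ hN₁ hN₂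
        h2e hσπ hππ hπN hx hy (hu1 0) (hu1 1) hP₂' had hab hbd mG _
        (hΦ₁ := fun Tl ψ t hform hψ hlev' hlit => classOrbitalIntegral_indicator_eq_phiZero_of_congr L H' hH' w hw hv hH'w hH'i μ hμ νH νG hmH hmG hνH hνG hl hr hH'u hμu hμω h2 hreg hint hP1 hlev
        hsplit α γ N₁ N₂ N hα hγ hαγ hN₁ hN₂ hN htri h2e hσπ hππ hπN hx hy (hu1 0) (hu1 1) hP₂' had hab hbd hu0 hu1w Tl ψ t hform hψ hlev' hlit)
        (hΦ₂ := fun Tl ψ t hform hψ hlev' hlit => classOrbitalIntegral_indicator_eq_phiOne_of_congr_splitTwo L H' hH' w hw hv hH'w hH'i μ hμ νH νG hmH hmG hνH hνG hl hr hH'u hμu hμω h2 hreg hint hP1 hlev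
        hsplit α γ N₁ N₂ N hα hγ hαγ hN₁ hN₂ hN htri h2e hσπ hππ hπN hx hy (hu1 0) (hu1 1) hP₂' had hab hbd hu0 hu1w Tl ψ t hform hψ hlev' hlit)
        (hΦ₃ := fun Tl ψ t hform hψ hlev' hlit => classOrbitalIntegral_indicator_eq_phiOne_of_congr_splitThree L H' hH' w hw hv hH'w hH'i μ hμ νH νG hmH hmG hνH hνG hl hr hH'u hμu hμω h2 hreg hint hP1 hlev
        hsplit α γ N₁ N₂ N hα hγ hαγ hN₁ hN₂ hN htri h2e hσπ hππ hπN hx hy (hu1 0) (hu1 1) hP₂' had hab hbd hu0 hu1w Tl ψ t hform hψ hlev' hlit)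
        (hΦ₄ := fun Tl ψ t hform hψ hlev' hlit => classOrbitalIntegral_indicator_eq_phiOne_of_congr_splitFour L H' hH' w hw hv hH'w hH'i μ hμ νH νG hmH hmG hνH hνG hl hr hH'u hμu hμω h2 hreg hint hP1 hlev
        hsplit α γ N₁ N₂ N hα hγ hαγ hN₁ hN₂ hN htri h2e hσπ hππ hπN hx hy (hu1 0) (hu1 1) hP₂' had hab hbd hu0 hu1w Tl ψ t hform hψ hlev' hlit)]
      have hz : (-(Ideal.absNorm v.asIdeal : ℂ)) ^ (-((N₁ : ℤ) + N₂)) = ((-(Ideal.absNorm v.asIdeal : ℂ)) ^ (N₁ + N₂))⁻¹ := by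
        rw [← Nat.cast_add, _root_.zpow_neg, zpow_natCast]
      rw [hz]
      push_cast [Flicker1998.phiKappa]
      ring
    rw [UnitaryGroup.stableOrbitalIntegralRel_indicator_eq_phiH_of_isRoot L v w hw νH hv hmH hνH hreg hlev α γ hα hγ hαγ N hN, hsum,
      Flicker1998.flicker_theorem15_div hq htri]
  · -- (P3)-irreducible: ELLIPTIC with `χ_g` irreducible over `L_w` — Flicker THM 18 on the torus `(EL)¹ × E¹`
    obtain ⟨n, N, M, hn, hN, hlaw⟩ := exists_irredExponents_of_hint L v w hw γH hv h2V hintV hsplit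
    have hnN : n ≤ 2 * N + 1 := hlaw ▸ min_le_left _ _
    have hpar : Even n ∨ n = 2 * N + 1 := by
      rcases le_total (2 * M) (2 * N + 1) with h | h
      · exact Or.inl ⟨M, by rw [hlaw, min_eq_right h]; ring⟩
      · exact Or.inr (by rw [hlaw, min_eq_left h])
    have hlog : WithZero.log (Valued.v (((finCharpolyTwo L v γH).eval (finGammaTwo L v γH)) w)) = -(n : ℤ) := by
      rw [hn, WithZero.log_exp]
    have halg := Flicker1998.flicker_theorem18n_halg (q := Ideal.absNorm v.asIdeal) hq hnN hpar
    rw [← hlog] at halg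
    -- the compact centraliser ★ (E4′), then ★ B-p14's adapter over the two `G′`-values ★ (κ = ±1) and the `H`-value ★ (F11-d)
    haveI := compactSpace_centralizer_of_not_exists_isRoot L v w hw hv γH h2 hint hsplit N hN
    exact stableOrbitalIntegralRel_indicator_eq_finsum_finExplicitDelta_of_not_exists_isRoot_of_values L H' hH' w hw hv hH'w hH'i μ hμ νH νG
      hmH hmG hνH hνG hl hr hH'u hμu hμω h2 hreg hint hP1 hlev hsplit
      (fun δ hδ hκ => classOrbitalIntegral_indicator_eq_phiTHn_of_finKappaAt_eq_one L H' hH' w hw hv hH'w hH'i νG hmG hνG hH'u h2 hreg hint hsplit n N hn hN δ hδ hκ)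
      (fun δ hδ hκ => classOrbitalIntegral_indicator_eq_phiTHprimen_of_finKappaAt_eq_neg_one L H' hH' hH'u w hw hv hH'w hH'i νG hmG hνG h2 hreg hint n N hn hN δ hδ hκ)
      (classOrbitalIntegral_indicator_eq_phiHtwo_of_not_exists_isRoot L v w hw νH hv hmH hνH hreg h2 hint hsplit N hN) halg

end PerPlace

/-! ## §2 The cofinite guard «`2 ∈ 𝒪_w^×`» (Flicker's standing `p ≠ 2`) -/

/-- **`2` is a `w`-adic unit at all but finitely many `v`** (the primes of `L` above `2` are finitely many — Mathlib `Ideal.finite_factors`; `IsUnit (2 : 𝒪_w) ↔ |2|_w = 1 ↔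
2 ∉ 𝔭_w`): Flicker's standing «`p ≠ 2`» is one more cofinite guard inside `S_bad`. [cite: Flicker1998UnitaryFL, §1 p. 74] [cite: CasselsFrohlichANT1967, Ch. VII Prop. 1.2 (ii)] -/
theorem eventually_forall_placesOver_isUnit_two (L : Type) [Field L] [NumberField L] [IsCMField L] :
    ∀ᶠ v : HeightOneSpectrum (𝓞 ↥(maximalRealSubfield L)) in Filter.cofinite, ∀ w : PlacesOver L v, IsUnit (2 : 𝒪[w.1.adicCompletion L]) := by
  have h2ne : Ideal.span {(2 : 𝓞 L)} ≠ ⊥ := by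
    rw [Ne, Ideal.span_singleton_eq_bot]; exact two_ne_zero
  have hfin : {Q : HeightOneSpectrum (𝓞 L) | Q.asIdeal ∣ Ideal.span {(2 : 𝓞 L)}}.Finite := Ideal.finite_factors h2ne
  refine Filter.eventually_cofinite.2 ((hfin.image fun Q => Q.under (𝓞 ↥(maximalRealSubfield L))).subset ?_)
  intro v hv
  rw [Set.mem_setOf_eq] at hv
  push Not at hv
  obtain ⟨w, hw⟩ := hv
  refine ⟨w.1, ?_, w.2⟩
  rw [Set.mem_setOf_eq, Ideal.dvd_span_singleton]
  by_contra hmem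
  apply hw
  rw [Valuation.Integers.isUnit_iff_valuation_eq_one (Valuation.integer.integers _),
    (ValuativeRel.isEquiv (ValuativeRel.valuation (w.1.adicCompletion L))
      (Valued.v : Valuation (w.1.adicCompletion L) (WithZero (Multiplicative ℤ)))).eq_one_iff_eq_one, map_ofNat]
  have h2L := Literature.NumberTheory.GaloisRepresentations.valued_algebraMap_adicCompletion w.1 (2 : L)
  rw [map_ofNat] at h2L
  rw [h2L, show (2 : L) = algebraMap (𝓞 L) L 2 from (map_ofNat (algebraMap (𝓞 L) L) 2).symm,
    HeightOneSpectrum.valuation_eq_one_iff_notMem]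
  exact hmem

/-! ## §3 The letter BY NAME: ★ abstract-guard socket + the cofinite guards + §1 ⇒ `UnitFundamentalLemmaExplicitNonsplitClosed` -/

/-- **`H` anisotropic ⟹ `det H ≠ 0`** (local copy, as in ★ `UnitFundamentalLemmaExplicitNonsplitOfPlaces`). [cite: Rogawski1990, §4.9 p. 54] -/
private theorem det_ne_zero_of_anisotropic {L : Type} [Field L] [NumberField L] [IsCMField L] {H : Matrix (Fin 3) (Fin 3) L}
    (hH0 : ∀ x : Fin 3 → L, Literature.AlgebraicGeometry.ShimuraVarieties.hermForm (cmConjRingHom L) H x x = 0 → x = 0) : H.det ≠ 0 := by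
  intro hdet
  obtain ⟨x, hx, hHx⟩ := Matrix.exists_mulVec_eq_zero_iff.mpr hdet
  refine hx (hH0 x ?_)
  rw [Literature.AlgebraicGeometry.ShimuraVarieties.hermForm, hHx, dotProduct_zero]

/-- **THE INERT UNIT FUNDAMENTAL LEMMA — `UnitFundamentalLemmaExplicitNonsplitClosed` HOLDS** (the named fact ★ p839598 DISCHARGED; the crux
closer's `stub_N7ns` statement BY NAME): for every CM field `L`, anisotropic Hermitian `H′`, unitary Hecke character `μ` restricting to
`ω_{L∕L⁺}`, and Haar data, there is a finite set `S_bad` of places of `L⁺` off which, at every NON-SPLIT place and for all canonical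
orbital-measure families, `Φ^st(γ_H, 1_{K_H}) = ∑ c, Δ‴_v(γ_H, c) Φ(c, 1_{K′})` for every `G`-regular `γ_H` [Rogawski1990, Prop. 4.9.1 (b);
BlasiusRogawski1992FL; Flicker1998UnitaryFL THM 15 ∕ THM 18].  Proof: ★ `unitFundamentalLemmaExplicitNonsplit_of_forall_place_of_eventually`
(the ABSTRACT-GUARD socket) with the cofinite guard «`v` unramified in `L`, `H′_w ∈ GL₃(𝒪_w)`, `μ` unramified at `w`
(★ `eventually_forall_placesOver_nonsplitGood`) AND `2 ∈ 𝒪_w^×` (§2)» — all inside `S_bad` — and §1 at the place `w ∣ v` (★ `PlacesOver.nonempty`;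
`c • w = w` from the non-split clause); the orbit-quotient measurable structures are the Borel ones.  `hherm` in the letter's spelling
`H′.map (cmConjRingHom L)` IS `H′.map (IsCMField.complexConj L)` (`rfl`).
[cite: Rogawski1990, §4.9 Prop. 4.9.1 (b) p. 55; §14.6 p. 242] [cite: Flicker1998UnitaryFL, Thm. 15 p. 95; Thm. 18 p. 97] -/
theorem unitFundamentalLemmaExplicitNonsplitClosed_holds :
    Literature.NumberTheory.Rogawski1990.UnitFundamentalLemmaExplicitNonsplitClosed :=
  fun L _ _ _ H' μ _ _ _ _ νH νG _ _ _ _ hμu hμω hherm hanis => by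
    letI : ∀ (v : HeightOneSpectrum (𝓞 ↥(maximalRealSubfield L)))
        (a : (UnitaryGroup.cmDatum L 2 (Matrix.of fun i j : Fin 2 => if i.val + j.val + 1 = 2 then (1 : L) else 0)).Local v ×
          (UnitaryGroup.cmDatum L 1 (Matrix.of fun i j : Fin 1 => if i.val + j.val + 1 = 1 then (1 : L) else 0)).Local v),
        MeasurableSpace (((UnitaryGroup.cmDatum L 2 (Matrix.of fun i j : Fin 2 => if i.val + j.val + 1 = 2 then (1 : L) else 0)).Local v ×
          (UnitaryGroup.cmDatum L 1 (Matrix.of fun i j : Fin 1 => if i.val + j.val + 1 = 1 then (1 : L) else 0)).Local v) ⧸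
          Subgroup.centralizer ({a} : Set ((UnitaryGroup.cmDatum L 2 (Matrix.of fun i j : Fin 2 => if i.val + j.val + 1 = 2 then (1 : L) else 0)).Local v ×
          (UnitaryGroup.cmDatum L 1 (Matrix.of fun i j : Fin 1 => if i.val + j.val + 1 = 1 then (1 : L) else 0)).Local v))) :=
      fun _ _ => borel _
    haveI : ∀ (v : HeightOneSpectrum (𝓞 ↥(maximalRealSubfield L)))
        (a : (UnitaryGroup.cmDatum L 2 (Matrix.of fun i j : Fin 2 => if i.val + j.val + 1 = 2 then (1 : L) else 0)).Local v ×
          (UnitaryGroup.cmDatum L 1 (Matrix.of fun i j : Fin 1 => if i.val + j.val + 1 = 1 then (1 : L) else 0)).Local v),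
        BorelSpace (((UnitaryGroup.cmDatum L 2 (Matrix.of fun i j : Fin 2 => if i.val + j.val + 1 = 2 then (1 : L) else 0)).Local v ×
          (UnitaryGroup.cmDatum L 1 (Matrix.of fun i j : Fin 1 => if i.val + j.val + 1 = 1 then (1 : L) else 0)).Local v) ⧸
          Subgroup.centralizer ({a} : Set ((UnitaryGroup.cmDatum L 2 (Matrix.of fun i j : Fin 2 => if i.val + j.val + 1 = 2 then (1 : L) else 0)).Local v ×
          (UnitaryGroup.cmDatum L 1 (Matrix.of fun i j : Fin 1 => if i.val + j.val + 1 = 1 then (1 : L) else 0)).Local v))) :=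
      fun _ _ => ⟨rfl⟩
    letI : ∀ (v : HeightOneSpectrum (𝓞 ↥(maximalRealSubfield L))) (γ : (UnitaryGroup.cmDatum L 3 H').Local v),
        MeasurableSpace ((UnitaryGroup.cmDatum L 3 H').Local v ⧸ Subgroup.centralizer ({γ} : Set ((UnitaryGroup.cmDatum L 3 H').Local v))) :=
      fun _ _ => borel _
    haveI : ∀ (v : HeightOneSpectrum (𝓞 ↥(maximalRealSubfield L))) (γ : (UnitaryGroup.cmDatum L 3 H').Local v),
        BorelSpace ((UnitaryGroup.cmDatum L 3 H').Local v ⧸ Subgroup.centralizer ({γ} : Set ((UnitaryGroup.cmDatum L 3 H').Local v))) :=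
      fun _ _ => ⟨rfl⟩
    have hH'u : IsUnit H' := (Matrix.isUnit_iff_isUnit_det H').2 (Ne.isUnit (det_ne_zero_of_anisotropic hanis))
    have hH' : (H'.map (IsCMField.complexConj L))ᵀ = H' := hherm
    have hgood : ∀ᶠ v : HeightOneSpectrum (𝓞 ↥(maximalRealSubfield L)) in Filter.cofinite, ∀ w : PlacesOver L v,
        (Algebra.IsUnramifiedIn (𝓞 L) v.asIdeal ∧ (UnitaryGroup.isUnit_placeForm H' hH'u w.1).unit ∈ glInt 3 (w.1.adicCompletion L) ∧
          μ.IsUnramifiedAt w.1) ∧ IsUnit (2 : 𝒪[w.1.adicCompletion L]) := by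
      filter_upwards [eventually_forall_placesOver_nonsplitGood L H' μ hH'u, eventually_forall_placesOver_isUnit_two L] with v ha hb w
      exact ⟨ha w, hb w⟩
    refine unitFundamentalLemmaExplicitNonsplit_of_forall_place_of_eventually L H' μ νH νG hgood ?_
    intro v hgv hns hKG hKH mH mG hmH hmG
    obtain ⟨w⟩ := UnitaryGroup.PlacesOver.nonempty L v
    exact isLocalUnitTransfer_of_nonsplit_of_isUnit_two L H' hH' w (hns w) (hgv w).1.1 (UnitaryGroup.isUnit_placeForm H' hH'u w.1)
      (hgv w).1.2.1 μ (hgv w).1.2.2 (νH v) (νG v) hmH hmG hKH hKG (finExplicitDelta_conj_left_all L H' μ)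
      (finExplicitDelta_conj_right_all L H' μ) hH'u hμu hμω (hgv w).2

end Literature.NumberTheory.Rogawski1990

end
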